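import Literature.Barriers.CriticalPhenomena.TimarBoxes
import HarnessLib

/-!
# Timár 2006, proof of Thm. 4.3: the offspring bound on the good event, and what the boxes
# depend on (regions, balls) — PROVED

Barrier catalogue `Literature/Barriers/CriticalPhenomena/`; continues `TimarBoxes.lean` (the
definitions) on the way to `Timar2006_noInfiniteLightClusters_holds`
(`TimarCriticalNonunimodularProofs.lean`). Á. Timár, Ann. Probab. 34 (2006) 2344–2364, proof of
Thm. 4.3, pp. 2354–2355. Proved here:

* `le_card_timarChildren_of_mem_timarGood` — on the good event of a vertex `x` of slab `b`,
  `k ≤ (deg + 1) · #children(x)`: a counted vertex of the lowest slab of the box is a child, one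
  of the slab above contributes the foot of its open long edge, which the SEALED component
  contains ("assign `f` children to it iff the open component of `x` in `B_x` is good and
  contains `f` vertices from" the next slab; "`f ≥ k` by being good", p. 2354) — this is the
  position-independent lower bound behind "Clearly, there is also a uniform choice" (p. 2354);
* `timarChildren_inter_timarRegion` — the children of a generation-`b` vertex only depend on the
  edges of the region `timarRegion G o b n`, and these regions are pairwise disjoint along the
  generations `b = 0, n+2, 2(n+2), …` (`timarRegion_disjoint`): "the edge sets in `B_x` and `B_y`
  are disjoint whenever `x ∈ G(ℓ_{gi+1}, ℓ_{gi}]`, `y ∈ G(ℓ_{g′i+1}, ℓ_{g′i}]` and `g ≠ g′`. Thus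
  `P[|O_{m+1}| = i | O_m, …, O_0] = P[|O_{m+1}| = i | O_m]`" (p. 2355);
* `timarChildren_inter_ballEdgeSet`, `timarGood_inter_ballEdgeSet` — children and the good
  event only depend on the edges inside `B(x, ρ + 1)` ("the numbers of children for `x̂` and `ŷ`
  are independent if `B_x` and `B_y` are disjoint", p. 2355; locality of the good event, used for
  its continuity in `p`).

## References

* Á. Timár, Ann. Probab. 34 (2006) 2344–2364 (arXiv:math/0702875), §4, proof of Thm. 4.3,
  pp. 2354–2355. [Timar2006]
-/

noncomputable section

namespace Literature.Barriers.CriticalPhenomena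

open _root_.MeasureTheory Literature.Probability.Percolation
open scoped _root_.ENNReal

variable {V : Type*}

/-! ### A measurability helper -/

/-- The sum of countably many measurable `ℝ≥0∞`-valued functions is measurable (Mathlib's
`Measurable.ennreal_tsum`, re-proved here to stay clear of its deprecation). [folklore] -/
theorem measurable_tsum_ennreal_of_countable {ι α : Type*} [MeasurableSpace α] [Countable ι]
    {f : ι → α → ℝ≥0∞} (h : ∀ i, Measurable (f i)) : Measurable fun x => ∑' i, f i x := by
  simp_rw [ENNReal.tsum_eq_iSup_sum]
  exact Measurable.iSup fun s => s.measurable_fun_sum fun i _ => h i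

section Good

variable {G : SimpleGraph V} [G.LocallyFinite] {o : V}

/-- The counted vertices lie in `B(x, ρ)`, so they form a finite set. [folklore] -/
theorem timarCountSet_finite (n ρ : ℕ) (x : V) (ω : BondConfig V) :
    (timarCountSet G o n ρ x ω).Finite :=
  (timarBoxCluster_finite x ρ _ ω).subset fun _ hy => hy.1

variable (hconn : G.Connected) (htr : IsGraphTransitive G) (hU : ¬ IsGraphUnimodular G)
include hconn htr hU

omit hconn htr hU in
/-- For `x ∈ slab b` the bottom `Δ^{b+n+3}` of its generation box lies in
`[Δ^{n+3} w(x), Δ^{n+2} w(x)]` — the box of the process sits between the two relative boxes of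
the good event. [folklore] -/
theorem timarBottom_mem_Icc {b n : ℕ} {x : V} (hx : x ∈ slab G o b) :
    minNbrWeight G o ^ (n + 3) * autWeight G o x ≤ timarBottom G o b n ∧
      timarBottom G o b n ≤ minNbrWeight G o ^ (n + 2) * autWeight G o x := by
  constructor
  · calc minNbrWeight G o ^ (n + 3) * autWeight G o x
          ≤ minNbrWeight G o ^ (n + 3) * minNbrWeight G o ^ b := by gcongr; exact hx.2
      _ = timarBottom G o b n := by rw [timarBottom]; ring
  · calc timarBottom G o b n = minNbrWeight G o ^ (n + 2) * minNbrWeight G o ^ (b + 1) := by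
          rw [timarBottom]; ring
      _ ≤ minNbrWeight G o ^ (n + 2) * autWeight G o x := by gcongr; exact hx.1.le

omit hconn htr hU in
/-- On the good event of a vertex `x` of slab `b`, the generation-`b` box component of `x`
(radius `r + 1`) is sealed. [cite: Timar2006, §4 (proof of Thm. 4.3)] -/
theorem timarSealed_of_mem_timarGood {b n r k : ℕ} {x : V} (hx : x ∈ slab G o b) {ω : BondConfig V}
    (hω : ω ∈ timarGood G o n r k x) : TimarSealed G o x (r + 1) (timarBottom G o b n) ω :=
  hω.1.mono (timarBottom_mem_Icc (n := n) hx).1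

/-- **Every counted vertex yields a child within one step**: on the good event, a counted vertex
`y` of a slab-`b` vertex `x` either is a child of `x` or has a child of `x` among its neighbours
(the foot of its open long edge, which lies in the lowest slab of the box and — the component
being sealed — in the component). [cite: Timar2006, §4 (proof of Thm. 4.3: the children of x̂)] -/
theorem timarCountSet_subset_iUnion {b n r k : ℕ} {x : V} (hx : x ∈ slab G o b)
    {ω : BondConfig V} (hω : ω ∈ timarGood G o n r k x) :
    timarCountSet G o n r x ω ⊆
      ⋃ c ∈ timarChildren G o b n (r + 1) x ω, insert c (G.neighborSet c) := by
  have h0 := minNbrWeight_ne_zero hconn o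
  have hT := minNbrWeight_ne_top hconn htr hU o
  have hseal := timarSealed_of_mem_timarGood hx hω
  have hIcc := timarBottom_mem_Icc (G := G) (n := n) hx
  intro y hy
  obtain ⟨hyK, hyw, u, hyu, hu, hopen⟩ := hy
  -- `y` lies in the generation box component (a bigger box)
  have hyK' : y ∈ timarBoxCluster G o x (r + 1) (timarBottom G o b n) ω :=
    timarBoxCluster_mono x (Nat.le_succ r) hIcc.2 ω hyK
  have hyx : y ≠ x := by
    rintro rfl
    have h1 : autWeight G o y * minNbrWeight G o ^ (n + 1) < autWeight G o y * 1 :=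
      ENNReal.mul_lt_mul_right (autWeight_ne_zero G hconn o y) (autWeight_ne_top G hconn o y)
        (pow_lt_one' (minNbrWeight_lt_one hconn htr hU o) (Nat.succ_ne_zero n))
    rw [mul_one, mul_comm] at h1
    exact absurd hyw (not_le.2 h1)
  have hβy : timarBottom G o b n < autWeight G o y :=
    (weight_of_mem_timarBox (timarBoxCluster_subset_timarBox x _ _ ω hyK') hyx).1
  -- weight window of `y`: `(Δ^{b+n+3}, Δ^{b+n+1}]`
  have hy_le : autWeight G o y ≤ minNbrWeight G o ^ (b + n + 1) :=
    calc autWeight G o y ≤ minNbrWeight G o ^ (n + 1) * autWeight G o x := hyw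
      _ ≤ minNbrWeight G o ^ (n + 1) * minNbrWeight G o ^ b := by gcongr; exact hx.2
      _ = minNbrWeight G o ^ (b + n + 1) := by ring
  rw [Set.mem_iUnion₂]
  by_cases hlow : autWeight G o y ≤ minNbrWeight G o ^ (b + n + 2)
  · -- `y` is in the lowest slab: it is a child itself
    refine ⟨y, ⟨hx, hseal, hyK', ?_, hlow⟩, Set.mem_insert y _⟩
    simpa only [timarBottom, show b + n + 2 + 1 = b + n + 3 by ring] using hβy
  · -- `y` is one slab up: the foot `u` of its open long edge is a child
    have hyslab : y ∈ slab G o (b + n + 1) := ⟨not_le.1 hlow, hy_le⟩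
    have huslab : u ∈ slab G o (b + n + 2) :=
      mem_slab_succ_of_autWeight_eq_mul hconn htr hU o hyslab hu
    have hβu : timarBottom G o b n < autWeight G o u := by
      simpa only [timarBottom, show b + n + 2 + 1 = b + n + 3 by ring] using huslab.1
    have huB : u ∈ timarBox G o x (r + 1) (timarBottom G o b n) := hseal hyK' hyx hyu hopen hβu
    have huK : u ∈ timarBoxCluster G o x (r + 1) (timarBottom G o b n) ω :=
      mem_timarBoxCluster_of_adj hyK' hyu hopen huB
    exact ⟨u, ⟨hx, hseal, huK, huslab⟩, Set.mem_insert_of_mem _ ((G.mem_neighborSet u y).2 hyu.symm)⟩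

/-- **The offspring bound on the good event**: for a vertex `x` of slab `b`,
`k ≤ (deg(o) + 1) · #children` on `timarGood G o n r k x` (each child accounts for itself and
its at most `deg(o)` neighbours among the counted vertices; degrees are constant by
transitivity). [cite: Timar2006, §4 (proof of Thm. 4.3: "f ≥ k by being good")] -/
theorem le_card_timarChildren_of_mem_timarGood {b n r k : ℕ} {x : V} (hx : x ∈ slab G o b)
    {ω : BondConfig V} (hω : ω ∈ timarGood G o n r k x) :
    k ≤ (G.degree o + 1) * (timarChildren G o b n (r + 1) x ω).ncard := by
  classical
  have hfinC := timarChildren_finite (G := G) (o := o) b n (r + 1) x ω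
  have hfinS := timarCountSet_finite (G := G) (o := o) n r x ω
  -- `k ≤ #countSet`
  have hk : k ≤ (timarCountSet G o n r x ω).ncard := by
    have h := hω.2
    rw [← hfinS.cast_ncard_eq] at h
    exact_mod_cast h
  refine hk.trans ?_
  -- `#countSet ≤ Σ_{c ∈ children} #(c ∪ N(c)) ≤ #children · (deg + 1)`
  have hsub := timarCountSet_subset_iUnion hconn htr hU hx hω
  have hfinU : (⋃ c ∈ timarChildren G o b n (r + 1) x ω, insert c (G.neighborSet c)).Finite :=
    hfinC.biUnion fun c _ => (G.neighborSet c).toFinite.insert c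
  calc (timarCountSet G o n r x ω).ncard
        ≤ (⋃ c ∈ timarChildren G o b n (r + 1) x ω, insert c (G.neighborSet c)).ncard :=
          Set.ncard_le_ncard hsub hfinU
    _ = (⋃ c ∈ hfinC.toFinset, insert c (G.neighborSet c)).ncard := by
          congr 1; ext v; simp only [Set.mem_iUnion, Set.Finite.mem_toFinset]
    _ ≤ ∑ c ∈ hfinC.toFinset, (insert c (G.neighborSet c)).ncard := ncard_biUnion_le _ _
    _ ≤ ∑ _c ∈ hfinC.toFinset, (G.degree o + 1) := by
          refine Finset.sum_le_sum fun c _ => ?_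
          calc (insert c (G.neighborSet c)).ncard ≤ (G.neighborSet c).ncard + 1 :=
                Set.ncard_insert_le c _
            _ = G.degree c + 1 := by
                rw [← SimpleGraph.coe_neighborFinset, Set.ncard_coe_finset,
                  SimpleGraph.card_neighborFinset_eq_degree]
            _ ≤ G.degree o + 1 := by gcongr; exact degree_le_of_isGraphTransitive htr o c
    _ = (G.degree o + 1) * (timarChildren G o b n (r + 1) x ω).ncard := by
          rw [Finset.sum_const, smul_eq_mul, mul_comm, Set.ncard_eq_toFinset_card _ hfinC]


/-! ### Restricting the configuration: a general principle -/

omit [G.LocallyFinite] hconn htr hU in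
/-- A constrained cluster only reads the edges of its step graph: restricting the configuration
to any `S ⊇ E(K)` does not change it. [folklore] -/
theorem openClusterIn_inter_of_subset {K : SimpleGraph V} {S : Set (Sym2 V)} (hS : K.edgeSet ⊆ S)
    (ω : BondConfig V) (x : V) : openClusterIn K (ω ∩ S) x = openClusterIn K ω x := by
  rw [← openClusterIn_inter_edgeSet K (ω ∩ S), Set.inter_assoc, Set.inter_eq_right.2 hS,
    openClusterIn_inter_edgeSet]

omit hconn htr hU in
/-- The edges of a box graph: steps of `G` between two vertices of the box. [folklore] -/
theorem mem_edgeSet_timarBoxGraph {x : V} {ρ : ℕ} {β : ℝ≥0∞} {u v : V} :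
    s(u, v) ∈ (timarBoxGraph G o x ρ β).edgeSet ↔
      G.Adj u v ∧ u ∈ timarBox G o x ρ β ∧ v ∈ timarBox G o x ρ β :=
  mem_edgeSet_withinGraph

omit hconn htr hU in
/-- **Box components and sealing only read a set of edges `S`** as soon as `S` contains the box
graph and every edge of `G` from a vertex of the box other than `x` to a vertex of weight `> β`:
then the children-relevant data of `ω` and `ω ∩ S` agree. [folklore] -/
theorem timarSealed_inter_iff {x : V} {ρ : ℕ} {β : ℝ≥0∞} {S : Set (Sym2 V)}
    (hK : (timarBoxGraph G o x ρ β).edgeSet ⊆ S)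
    (hS : ∀ v ∈ timarBox G o x ρ β, v ≠ x → ∀ u, G.Adj v u → β < autWeight G o u → s(v, u) ∈ S)
    (ω : BondConfig V) :
    TimarSealed G o x ρ β (ω ∩ S) ↔ TimarSealed G o x ρ β ω := by
  have hK' : timarBoxCluster G o x ρ β (ω ∩ S) = timarBoxCluster G o x ρ β ω :=
    openClusterIn_inter_of_subset hK ω x
  simp only [TimarSealed, hK']
  constructor
  · intro h v hv hvx u hadj hopen hβ
    exact h hv hvx hadj ⟨hopen, hS v (timarBoxCluster_subset_timarBox x ρ β ω hv) hvx u hadj hβ⟩ hβ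
  · intro h v hv hvx u hadj hopen hβ
    exact h hv hvx hadj hopen.1 hβ

/-! ### Regions -/

/-- The box graph of a slab-`b` vertex (bottom `Δ^{b+n+3}`) lies in the region of generation `b`.
[cite: Timar2006, §4 (proof of Thm. 4.3: the edge sets of the boxes of one generation)] -/
theorem edgeSet_timarBoxGraph_subset_timarRegion {b : ℕ} (n ρ : ℕ) {x : V} (hx : x ∈ slab G o b) :
    (timarBoxGraph G o x ρ (timarBottom G o b n)).edgeSet ⊆ timarRegion G o b n := by
  intro e he
  induction e using Sym2.ind with
  | h u v =>
    rw [mem_edgeSet_timarBoxGraph] at he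
    obtain ⟨hadj, hu, hv⟩ := he
    have hβx : timarBottom G o b n < autWeight G o x := timarBottom_lt_of_mem_slab hconn htr hU n hx
    have hwt : ∀ w ∈ timarBox G o x ρ (timarBottom G o b n), timarBottom G o b n < autWeight G o w :=
      fun w hw => by
        rcases hw with rfl | ⟨-, h, -⟩
        · exact hβx
        · exact h
    have hlow : ∀ w ∈ timarBox G o x ρ (timarBottom G o b n), w ≠ x →
        autWeight G o w ≤ minNbrWeight G o ^ (b + 1) := fun w hw hwx =>
      calc autWeight G o w ≤ minNbrWeight G o * autWeight G o x := (weight_of_mem_timarBox hw hwx).2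
        _ ≤ minNbrWeight G o * minNbrWeight G o ^ b := by gcongr; exact hx.2
        _ = minNbrWeight G o ^ (b + 1) := by ring
    refine ⟨(SimpleGraph.mem_edgeSet G).2 hadj, ?_, ?_⟩
    · intro w hw
      rcases Sym2.mem_iff.1 hw with rfl | rfl
      · exact hwt _ hu
      · exact hwt _ hv
    · by_cases hux : u = x
      · have hvx : v ≠ x := fun h => hadj.ne (hux.trans h.symm)
        exact ⟨v, Sym2.mem_mk_right u v, hlow v hv hvx⟩
      · exact ⟨u, Sym2.mem_mk_left u v, hlow u hu hux⟩

omit hconn htr hU in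
/-- The sealing edges of a slab-`b` vertex lie in the region of generation `b`. [folklore] -/
theorem sealingEdge_mem_timarRegion {b : ℕ} (n ρ : ℕ) {x : V} (hx : x ∈ slab G o b) {v : V}
    (hv : v ∈ timarBox G o x ρ (timarBottom G o b n)) (hvx : v ≠ x) {u : V} (hadj : G.Adj v u)
    (hβ : timarBottom G o b n < autWeight G o u) : s(v, u) ∈ timarRegion G o b n := by
  have hw := weight_of_mem_timarBox hv hvx
  refine ⟨(SimpleGraph.mem_edgeSet G).2 hadj, ?_, ⟨v, Sym2.mem_mk_left v u, ?_⟩⟩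
  · intro w hw'
    rcases Sym2.mem_iff.1 hw' with rfl | rfl
    · exact hw.1
    · exact hβ
  · calc autWeight G o v ≤ minNbrWeight G o * autWeight G o x := hw.2
      _ ≤ minNbrWeight G o * minNbrWeight G o ^ b := by gcongr; exact hx.2
      _ = minNbrWeight G o ^ (b + 1) := by ring

/-- **The children of a generation-`b` vertex only depend on the edges of the region of
generation `b`.** [cite: Timar2006, §4 (proof of Thm. 4.3: "P[|O_{m+1}| = i | O_m, …, O_0] = P[|O_{m+1}| = i | O_m]")] -/
theorem timarChildren_inter_timarRegion (b n ρ : ℕ) (x : V) (ω : BondConfig V) :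
    timarChildren G o b n ρ x (ω ∩ timarRegion G o b n) = timarChildren G o b n ρ x ω := by
  by_cases hx : x ∈ slab G o b
  · have hK := edgeSet_timarBoxGraph_subset_timarRegion hconn htr hU n ρ hx
    have hKeq : timarBoxCluster G o x ρ (timarBottom G o b n) (ω ∩ timarRegion G o b n) =
        timarBoxCluster G o x ρ (timarBottom G o b n) ω := openClusterIn_inter_of_subset hK ω x
    have hSeq := timarSealed_inter_iff hK
      (fun v hv hvx u hadj hβ => sealingEdge_mem_timarRegion n ρ hx hv hvx hadj hβ) ω
    ext c
    simp only [timarChildren, Set.mem_setOf_eq, hKeq, hSeq]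
  · ext c
    simp only [timarChildren, Set.mem_setOf_eq, hx, false_and]

/-- **The regions of different generations are disjoint**: for `b′ ≥ b + n + 2` the regions of
generations `b` and `b′` share no edge (an edge of the later region has an endpoint of weight
`≤ Δ^{b′+1} ≤ Δ^{b+n+3}`, the bottom of the earlier one).
[cite: Timar2006, §4 (proof of Thm. 4.3: edge sets of different generations are disjoint)] -/
theorem timarRegion_disjoint {b b' : ℕ} (n : ℕ) (h : b + n + 2 ≤ b') :
    Disjoint (timarRegion G o b n) (timarRegion G o b' n) := by
  rw [Set.disjoint_left]
  rintro e ⟨-, habove, -⟩ ⟨-, -, u, hu, hle⟩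
  have h1 := habove u hu
  have h2 : minNbrWeight G o ^ (b' + 1) ≤ timarBottom G o b n :=
    (minNbrWeight_pow_le_pow_iff hconn htr hU o).2 (by omega)
  exact absurd (lt_of_lt_of_le h1 (hle.trans h2)) (lt_irrefl _)

/-- The regions of the generations `g (n+2)`, `g ∈ ℕ`, are pairwise disjoint. [folklore] -/
theorem timarRegion_disjoint_of_ne (n : ℕ) {g g' : ℕ} (h : g ≠ g') :
    Disjoint (timarRegion G o (g * (n + 2)) n) (timarRegion G o (g' * (n + 2)) n) := by
  wlog hlt : g < g' generalizing g g'
  · exact (this h.symm (lt_of_le_of_ne (not_lt.1 hlt) h.symm)).symm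
  refine timarRegion_disjoint hconn htr hU n ?_
  have : (g + 1) * (n + 2) ≤ g' * (n + 2) := Nat.mul_le_mul_right _ hlt
  nlinarith

/-! ### Locality: children and the good event only read the edges of a ball -/

omit hconn htr hU in
/-- The box graph of radius `ρ` around `x` only has edges inside `B(x, ρ + 1)` (indeed inside
`B(x, ρ)`). [folklore] -/
theorem edgeSet_timarBoxGraph_subset_ballEdgeSet (x : V) (ρ : ℕ) (β : ℝ≥0∞) :
    (timarBoxGraph G o x ρ β).edgeSet ⊆ ballEdgeSet G x (ρ + 1) := by
  intro e he
  induction e using Sym2.ind with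
  | h u v =>
    rw [mem_edgeSet_timarBoxGraph] at he
    refine ⟨(SimpleGraph.mem_edgeSet G).2 he.1, fun w hw => ?_⟩
    rcases Sym2.mem_iff.1 hw with rfl | rfl
    · exact graphBall_mono G x (Nat.le_succ ρ) (timarBox_subset_graphBall x ρ β he.2.1)
    · exact graphBall_mono G x (Nat.le_succ ρ) (timarBox_subset_graphBall x ρ β he.2.2)

omit [G.LocallyFinite] hconn htr hU in
/-- A step of `G` from a vertex of `B(x, ρ)` stays in `B(x, ρ + 1)`. [folklore] -/
theorem mem_graphBall_succ_of_adj {x v u : V} {ρ : ℕ} (hv : v ∈ graphBall G x ρ) (h : G.Adj v u) :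
    u ∈ graphBall G x (ρ + 1) := by
  obtain ⟨w, hw⟩ := hv
  exact ⟨w.append (SimpleGraph.Walk.cons h SimpleGraph.Walk.nil),
    by rw [SimpleGraph.Walk.length_append, SimpleGraph.Walk.length_cons, SimpleGraph.Walk.length_nil]; omega⟩

omit hconn htr hU in
/-- An edge of `G` from a vertex of the box of radius `ρ` lies inside `B(x, ρ + 1)`. [folklore] -/
theorem sealingEdge_mem_ballEdgeSet {x : V} {ρ : ℕ} {β : ℝ≥0∞} {v u : V}
    (hv : v ∈ timarBox G o x ρ β) (hadj : G.Adj v u) : s(v, u) ∈ ballEdgeSet G x (ρ + 1) := by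
  have hvB := timarBox_subset_graphBall x ρ β hv
  refine ⟨(SimpleGraph.mem_edgeSet G).2 hadj, fun w hw => ?_⟩
  rcases Sym2.mem_iff.1 hw with rfl | rfl
  · exact graphBall_mono G x (Nat.le_succ ρ) hvB
  · exact mem_graphBall_succ_of_adj hvB hadj

omit hconn htr hU in
/-- **Children only read the edges inside `B(x, ρ + 1)`.** [cite: Timar2006, §4 (proof of Thm. 4.3: "the numbers of children for x̂ and ŷ are independent if B_x and B_y are disjoint")] -/
theorem timarChildren_inter_ballEdgeSet (b n ρ : ℕ) (x : V) (ω : BondConfig V) :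
    timarChildren G o b n ρ x (ω ∩ ballEdgeSet G x (ρ + 1)) = timarChildren G o b n ρ x ω := by
  have hK := edgeSet_timarBoxGraph_subset_ballEdgeSet (G := G) (o := o) x ρ (timarBottom G o b n)
  have hKeq : timarBoxCluster G o x ρ (timarBottom G o b n) (ω ∩ ballEdgeSet G x (ρ + 1)) =
      timarBoxCluster G o x ρ (timarBottom G o b n) ω := openClusterIn_inter_of_subset hK ω x
  have hSeq := timarSealed_inter_iff hK
    (fun v hv _ u hadj _ => sealingEdge_mem_ballEdgeSet hv hadj) ω
  ext c
  simp only [timarChildren, Set.mem_setOf_eq, hKeq, hSeq]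

omit hconn htr hU in
/-- The steep-open condition at a vertex of `B(x, ρ)` only reads edges inside `B(x, ρ + 1)`.
[folklore] -/
theorem timarSteepOpen_inter_iff {x y : V} {ρ : ℕ} (hy : y ∈ graphBall G x ρ) {S : Set (Sym2 V)}
    (hS : ballEdgeSet G x (ρ + 1) ⊆ S) (ω : BondConfig V) :
    TimarSteepOpen G o y (ω ∩ S) ↔ TimarSteepOpen G o y ω := by
  constructor
  · rintro ⟨u, hadj, hw, hopen⟩
    exact ⟨u, hadj, hw, hopen.1⟩
  · rintro ⟨u, hadj, hw, hopen⟩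
    refine ⟨u, hadj, hw, hopen, hS ⟨(SimpleGraph.mem_edgeSet G).2 hadj, fun w hw' => ?_⟩⟩
    rcases Sym2.mem_iff.1 hw' with rfl | rfl
    · exact graphBall_mono G x (Nat.le_succ ρ) hy
    · exact mem_graphBall_succ_of_adj hy hadj

omit hconn htr hU in
/-- **The good event of `x` (radii `r`, `r + 1`) only reads the edges inside `B(x, r + 2)`** — it
is a local event. [cite: Timar2006, §4 (proof of Thm. 4.3: goodness is decided inside B_x(i; r))] -/
theorem timarGood_inter_ballEdgeSet (n r k : ℕ) (x : V) (ω : BondConfig V) :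
    ω ∩ ballEdgeSet G x (r + 2) ∈ timarGood G o n r k x ↔ ω ∈ timarGood G o n r k x := by
  have hB : ballEdgeSet G x (r + 1) ⊆ ballEdgeSet G x (r + 2) :=
    fun e he => ⟨he.1, fun u hu => graphBall_mono G x (by omega) (he.2 u hu)⟩
  -- sealing part (radius `r + 1`)
  have hK1 := (edgeSet_timarBoxGraph_subset_ballEdgeSet (G := G) (o := o) x (r + 1)
    (minNbrWeight G o ^ (n + 3) * autWeight G o x))
  have hS1 := timarSealed_inter_iff hK1 (fun v hv _ u hadj _ => sealingEdge_mem_ballEdgeSet hv hadj) ω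
  -- counting part (radius `r`)
  have hK0 := (edgeSet_timarBoxGraph_subset_ballEdgeSet (G := G) (o := o) x r
    (minNbrWeight G o ^ (n + 2) * autWeight G o x)).trans hB
  have hKeq : timarBoxCluster G o x r (minNbrWeight G o ^ (n + 2) * autWeight G o x)
      (ω ∩ ballEdgeSet G x (r + 2)) =
      timarBoxCluster G o x r (minNbrWeight G o ^ (n + 2) * autWeight G o x) ω :=
    openClusterIn_inter_of_subset hK0 ω x
  have hC : timarCountSet G o n r x (ω ∩ ballEdgeSet G x (r + 2)) = timarCountSet G o n r x ω := by
    ext y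
    simp only [timarCountSet, Set.mem_setOf_eq, hKeq]
    constructor
    · rintro ⟨hy, hw, hs⟩
      exact ⟨hy, hw, (timarSteepOpen_inter_iff (timarBox_subset_graphBall x r _
        (timarBoxCluster_subset_timarBox x r _ ω hy)) hB _).1 hs⟩
    · rintro ⟨hy, hw, hs⟩
      exact ⟨hy, hw, (timarSteepOpen_inter_iff (timarBox_subset_graphBall x r _
        (timarBoxCluster_subset_timarBox x r _ ω hy)) hB _).2 hs⟩
  simp only [timarGood, Set.mem_setOf_eq, hS1, hC]

end Good

end Literature.Barriers.CriticalPhenomena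

end
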